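import Literature.NumberTheory.EllipticCurves.Greenberg1999.TwoTorsionLines
import Literature.NumberTheory.EllipticCurves.GeomPointReduction
import Literature.NumberTheory.EllipticCurves.OrdinaryReductionKernelTorsionProofs
import Literature.NumberTheory.EllipticCurves.SerreOpenImageOrdinaryInertiaProofs
import Literature.NumberTheory.EllipticCurves.UnramifiedLayerRootsProofs
import HarnessLib

/-!
# Greenberg's line dictionary at `p = 2`, PROOF of the kernel-of-reduction half
# (`twoTorsion_mem_kernelReduction_iff_ramifiedAtTwo_holds`)

Discharges the named fact `Greenberg1999.twoTorsion_mem_kernelReduction_iff_ramifiedAtTwo` of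
`Greenberg1999/TwoTorsionLines.lean` in the kernel (no hypotheses): at a prime `2` of GOOD reduction
of a globally minimal `E/ℚ`, a rational point `P = (x, y)` of order `2` reduces to `Õ` along the
tree's reduction map of the local integral model over the valuation ring `𝒪_w` of `K̄_v` (`v ∣ 2`)
if and only if `v₂(x) < 0` (`TwoTorsionRamifiedAtTwo x`). Proof (Silverman, *AEC*, VII.2.1): good
reduction makes every point of `E(K̄_v)` a point of non-singular reduction
(`hasNonsingularReduction_of_isUnit_Δ`), so the kernel of reduction is `E₁` = the points whose
abscissa is not `w`-integral (`reducePoint_eq_zero_iff`, `reducesToZero_some_iff`); and a rational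
`x` is `w`-integral iff `2 ∤ den x` iff `0 ≤ v₂(x)` (`w(num x) = 1` or `w(den x) = 1` by coprimality,
`w(2) < 1`).

References: [GreenbergLNM1716] §5 pp. 170–176; [SilvermanAEC2009] VII.2.1, VII.5.1(a).
-/

noncomputable section

open scoped Classical NNReal

open NumberField IsDedekindDomain IsDedekindDomain.HeightOneSpectrum Field WeierstrassCurve
  Literature.NumberTheory.EllipticCurves

namespace Literature.NumberTheory.EllipticCurves.Greenberg1999

variable {v : HeightOneSpectrum (𝓞 ℚ)}
  {w : Valuation (AlgebraicClosure (v.adicCompletion ℚ)) ℝ≥0}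

/-! ## §1 Valuations of rationals in `K̄_v`, `v ∣ 2` -/

/-- `v₂(x) < 0 ↔ 2 ∣ den x` (numerator and denominator are coprime). [folklore] -/
private theorem padicValRat_two_neg_iff_dvd_den (x : ℚ) : padicValRat 2 x < 0 ↔ 2 ∣ x.den := by
  haveI : Fact (Nat.Prime 2) := ⟨Nat.prime_two⟩
  constructor
  · intro h
    by_contra hden
    rw [padicValRat_def, padicValNat.eq_zero_of_not_dvd hden] at h
    omega
  · intro hden
    have hnum : ¬ (2 : ℤ) ∣ x.num := by
      intro hnum
      have h2 : 2 ∣ Nat.gcd x.num.natAbs x.den := Nat.dvd_gcd (Int.natCast_dvd.mp hnum) hden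
      rw [x.reduced.gcd_eq_one] at h2
      exact absurd (Nat.dvd_one.mp h2) (by norm_num)
    have h1 : 1 ≤ padicValNat 2 x.den := one_le_padicValNat_of_dvd x.den_nz hden
    rw [padicValRat_def, padicValInt.eq_zero_of_not_dvd hnum]
    omega

variable (hv : ((2 : ℕ) : 𝓞 ℚ) ∈ v.asIdeal)
  (hw : ∀ z, (w z : ℝ) = spectralNorm (v.adicCompletion ℚ) (AlgebraicClosure (v.adicCompletion ℚ)) z)

include hw in
/-- An integer is `w`-integral in `K̄_v`. [folklore] -/
private theorem spectralValuation_intCast_le_one_two (n : ℤ) :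
    w ((n : ℤ) : AlgebraicClosure (v.adicCompletion ℚ)) ≤ 1 := by
  have h := (spectralValuation_algebraMap_le_one_iff hw ((n : ℤ) : v.adicCompletion ℚ)).mpr
    (intCast_mem (v.adicCompletionIntegers ℚ) n)
  rwa [map_intCast] at h

include hv hw in
/-- **A rational with odd denominator is `w`-integral in `K̄_v`, `v ∣ 2`** (`w(den x) = 1`).
[folklore] -/
private theorem spectralValuation_ringHom_rat_le_one (f : ℚ →+* AlgebraicClosure (v.adicCompletion ℚ)) {x : ℚ}
    (hx : ¬ 2 ∣ x.den) : w (f x) ≤ 1 := by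
  haveI : Fact (Nat.Prime 2) := ⟨Nat.prime_two⟩
  have hden : w ((x.den : ℤ) : AlgebraicClosure (v.adicCompletion ℚ)) = 1 :=
    spectralValuation_intCast_eq_one_of_natCast_mem hv hw (by exact_mod_cast hx)
  have hmul : f x * ((x.den : ℤ) : AlgebraicClosure (v.adicCompletion ℚ)) =
      (x.num : AlgebraicClosure (v.adicCompletion ℚ)) := by
    have h := congrArg f (Rat.mul_den_eq_num x)
    rwa [map_mul, map_natCast, map_intCast, ← Int.cast_natCast] at h
  have h1 : w (f x) = w (f x * ((x.den : ℤ) : AlgebraicClosure (v.adicCompletion ℚ))) := by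
    rw [map_mul, hden, mul_one]
  rw [h1, hmul]
  exact spectralValuation_intCast_le_one_two hw x.num

include hv hw in
/-- **A rational with even denominator is NOT `w`-integral in `K̄_v`, `v ∣ 2`**: `w(x) > 1`
(`w(num x) = 1` by coprimality, `w(den x) ≤ w(2) < 1`). [folklore] -/
private theorem one_lt_spectralValuation_ringHom_rat (f : ℚ →+* AlgebraicClosure (v.adicCompletion ℚ)) {x : ℚ}
    (hx : 2 ∣ x.den) : 1 < w (f x) := by
  haveI : Fact (Nat.Prime 2) := ⟨Nat.prime_two⟩
  have hnum : ¬ (2 : ℤ) ∣ x.num := by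
    intro hnum
    have h2 : 2 ∣ Nat.gcd x.num.natAbs x.den := Nat.dvd_gcd (Int.natCast_dvd.mp hnum) hx
    rw [x.reduced.gcd_eq_one] at h2
    exact absurd (Nat.dvd_one.mp h2) (by norm_num)
  have hnum1 : w ((x.num : ℤ) : AlgebraicClosure (v.adicCompletion ℚ)) = 1 :=
    spectralValuation_intCast_eq_one_of_natCast_mem hv hw hnum
  have h2 : w ((2 : ℕ) : AlgebraicClosure (v.adicCompletion ℚ)) < 1 := by
    have h := spectralValuation_algebraMap_ringOfIntegers_lt_one (v := v) hw hv
    rwa [map_natCast] at h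
  obtain ⟨m, hm⟩ := hx
  have hden_lt : w ((x.den : ℤ) : AlgebraicClosure (v.adicCompletion ℚ)) < 1 := by
    rw [Int.cast_natCast, hm, Nat.cast_mul, map_mul]
    calc w ((2 : ℕ) : AlgebraicClosure (v.adicCompletion ℚ)) * w ((m : ℕ) : AlgebraicClosure (v.adicCompletion ℚ))
        ≤ w ((2 : ℕ) : AlgebraicClosure (v.adicCompletion ℚ)) * 1 := by
          refine mul_le_mul' le_rfl ?_
          have h := spectralValuation_intCast_le_one_two hw (m : ℤ)
          rwa [Int.cast_natCast] at h
      _ < 1 := by rw [mul_one]; exact h2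
  have hmul : f x * ((x.den : ℤ) : AlgebraicClosure (v.adicCompletion ℚ)) =
      (x.num : AlgebraicClosure (v.adicCompletion ℚ)) := by
    have h := congrArg f (Rat.mul_den_eq_num x)
    rwa [map_mul, map_natCast, map_intCast, ← Int.cast_natCast] at h
  have hprod : w (f x) * w ((x.den : ℤ) : AlgebraicClosure (v.adicCompletion ℚ)) = 1 := by
    rw [← map_mul, hmul, hnum1]
  by_contra hle
  have hle' : w (f x) ≤ 1 := not_lt.mp hle
  have h : (1 : ℝ≥0) < 1 :=
    calc (1 : ℝ≥0) = w (f x) * w ((x.den : ℤ) : AlgebraicClosure (v.adicCompletion ℚ)) := hprod.symm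
      _ ≤ 1 * w ((x.den : ℤ) : AlgebraicClosure (v.adicCompletion ℚ)) := mul_le_mul' hle' le_rfl
      _ < 1 := by rw [one_mul]; exact hden_lt
  exact lt_irrefl _ h

/-! ## §2 The kernel-of-reduction half of the dictionary -/

/-- **Greenberg's dictionary at `p = 2`, kernel-of-reduction half, PROVED**: the named fact
`twoTorsion_mem_kernelReduction_iff_ramifiedAtTwo` holds. At a good prime `2` every point of
`E(K̄_v)` has non-singular reduction, so `P = (x, y)` reduces to `Õ` iff `x ∉ 𝒪_w` iff `w(x) > 1`
iff `2 ∣ den x` iff `v₂(x) < 0`. [cite: GreenbergLNM1716, §5 pp. 170–176]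
[cite: SilvermanAEC2009, Prop. VII.2.1 and Prop. VII.5.1(a)] -/
theorem twoTorsion_mem_kernelReduction_iff_ramifiedAtTwo_holds :
    twoTorsion_mem_kernelReduction_iff_ramifiedAtTwo := by
  intro W _ _ hgood v hv w hw red₀ hred₀ x y hxy _h2
  haveI : Fact (Nat.Prime 2) := ⟨Nat.prime_two⟩
  have hvO : w.Integers w.valuationSubring := Valuation.valuationSubring.integers w
  have hΔ : ¬ ((2 : ℕ) : ℤ) ∣ minimalDiscriminantInt W :=
    WeierstrassCurve.not_dvd_minimalDiscriminantInt_of_hasGoodReductionAtPrime' W 2 hgood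
  have hΔu : IsUnit ((integralModelInt W).map (algebraMap ℤ ↥w.valuationSubring)).Δ :=
    W.isUnit_Δ_localIntModel hv hw hΔ
  -- the local point underlying `P`, with coordinates `ι x`, `ι y` for the embedding `ι : ℚ → K̄_v`
  have hcx : closureEmb (K := ℚ) (v.adicCompletion ℚ) (algebraMap ℚ (AlgebraicClosure ℚ) x) =
      algebraMap ℚ (AlgebraicClosure (v.adicCompletion ℚ)) x :=
    (closureEmb (K := ℚ) (v.adicCompletion ℚ)).commutes x
  have hcy : closureEmb (K := ℚ) (v.adicCompletion ℚ) (algebraMap ℚ (AlgebraicClosure ℚ) y) =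
      algebraMap ℚ (AlgebraicClosure (v.adicCompletion ℚ)) y :=
    (closureEmb (K := ℚ) (v.adicCompletion ℚ)).commutes y
  have hns : (W.baseChange (AlgebraicClosure (v.adicCompletion ℚ))).toAffine.Nonsingular
      (algebraMap ℚ (AlgebraicClosure (v.adicCompletion ℚ)) x)
      (algebraMap ℚ (AlgebraicClosure (v.adicCompletion ℚ)) y) :=
    (Affine.map_nonsingular _ (algebraMap ℚ (AlgebraicClosure (v.adicCompletion ℚ))).injective
      _ _).mpr hxy
  have hns' : (W.baseChange (AlgebraicClosure (v.adicCompletion ℚ))).toAffine.Nonsingular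
      (closureEmb (K := ℚ) (v.adicCompletion ℚ) (algebraMap ℚ (AlgebraicClosure ℚ) x))
      (closureEmb (K := ℚ) (v.adicCompletion ℚ) (algebraMap ℚ (AlgebraicClosure ℚ) y)) := by
    rw [hcx, hcy]; exact hns
  have hP : pointsMap W (v.adicCompletion ℚ) (toGeomPoints W (.some x y hxy)) =
      (show localPoints W (v.adicCompletion ℚ) from
        Affine.Point.some _ _ hns') := rfl
  -- the key computation on an affine point with abscissa `ι x`
  have key : ∀ (X Y : AlgebraicClosure (v.adicCompletion ℚ))
      (hXY : (W.baseChange (AlgebraicClosure (v.adicCompletion ℚ))).toAffine.Nonsingular X Y),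
      X = algebraMap ℚ (AlgebraicClosure (v.adicCompletion ℚ)) x →
      (red₀ (show localPoints W (v.adicCompletion ℚ) from Affine.Point.some X Y hXY) = 0 ↔
        TwoTorsionRamifiedAtTwo x) := by
    intro X Y hXY hX
    rw [hred₀]
    change ((integralModelInt W).map (algebraMap ℤ ↥w.valuationSubring)).reducePoint
      ((Affine.Point.congrEquiv (localIntModel_baseChange W w.valuationSubring).symm)
        (Affine.Point.some X Y hXY)) = 0 ↔ _
    rw [Affine.Point.congrEquiv_some,
      WeierstrassCurve.reducePoint_eq_zero_iff hvO (hasNonsingularReduction_of_isUnit_Δ hvO hΔu _),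
      WeierstrassCurve.reducesToZero_some_iff, TwoTorsionRamifiedAtTwo, padicValRat_two_neg_iff_dvd_den, hX]
    constructor
    · intro hnot
      by_contra hden
      exact hnot ⟨⟨algebraMap ℚ _ x, (Valuation.mem_valuationSubring_iff w _).mpr
        (spectralValuation_ringHom_rat_le_one hv hw (algebraMap ℚ _) hden)⟩, rfl⟩
    · rintro hden ⟨a, ha⟩
      have hle : w (algebraMap ℚ (AlgebraicClosure (v.adicCompletion ℚ)) x) ≤ 1 := by
        rw [← ha]; exact (Valuation.mem_valuationSubring_iff w _).mp a.2
      exact absurd hle (not_le.mpr (one_lt_spectralValuation_ringHom_rat hv hw (algebraMap ℚ _) hden))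
  rw [hP]
  exact key _ _ hns' hcx

end Literature.NumberTheory.EllipticCurves.Greenberg1999

end
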